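import Literature.Geometry.Kaehler.ComplexTorusEquivariantEndomorphismAlgebraCommutantCyclicPowersIdempotents
import HarnessLib

/-!
# The squarefree certificate on a product: a diagonal endomorphism `(u₁, u₂)` of `X₁ × X₂` of finite order has
# `D(u₁, u₂) = D(u₁) ∪ D(u₂)`, `h_d(u₁, u₂) = h_d(u₁) + h_d(u₂)`, and is a CM certificate iff `u₁`, `u₂` are and
# `D(u₁) ∩ D(u₂) = ∅`

Layer `Literature/Geometry/Kaehler`, namespace `Literature.Geometry.Kaehler.ComplexTorus` (§1 in
`Literature.Geometry.Kaehler.CyclotomicIdempotents`); lane `lit-hodgefound` (Track 2 foundations library), Layer A2,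
row «A2-26(ff)» (self-proposed 2026-08-28, prover seat `lit-hodgefound-p10`, generation 28, FILE 7).  The running
examples of generations 26–28 live on PRODUCTS of CM elliptic curves: `(i, i)` on `E_i × E_i` fails the squarefree
test (`P^r = Φ_4²`), `(i, ω)` on `E_i × E_ω` passes (`P^r = Φ_4 Φ_3`), and on `E_i × E_i` only the non-diagonal
`swapI` (FILE 1) passes.  THIS FILE proves the structure behind these computations for an arbitrary diagonal
endomorphism `w = (u₁, u₂) ∈ End_ℚ(X₁ × X₂)` (`ρ_r(w) = ρ_r(u₁) ⊕ ρ_r(u₂)` in block form, the tree's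
`fromBlocks_mem_endAlgRat_prod_iff`) with `u₁ⁿ = u₂ⁿ = 1`: the isotypic idempotents are diagonal,
`e_d(w) = (e_d(u₁), e_d(u₂))`, so the EIGENVALUE ORDERS UNITE, `D(w) = D(u₁) ∪ D(u₂)`, the MULTIPLICITIES ADD,
`h_d(w) = h_d(u₁) + h_d(u₂)` (`rk Λ(X^{e_d(w)}) = Tr e_d(w) = Tr e_d(u₁) + Tr e_d(u₂)`), `P^r_w = P^r_{u₁} P^r_{u₂}`, and
therefore **`P^r_w` is squarefree iff `P^r_{u₁}` and `P^r_{u₂}` are squarefree and `D(u₁) ∩ D(u₂) = ∅`** (`h_d ≤ 1`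
for all `d` iff `h_d(u_j) ≤ 1` and never both `= 1`).  Instances: `(ω, −ω)` on `E_ω × E_ω` (`D(ω) = {3}`,
`D(−ω) = {6}`, disjoint) IS a diagonal certificate of finite order — whereas `(i, −i)` on `E_i × E_i`
(`D = {4} = {4}`) is not, like `(i, i)`.  CONSUMED BY NAME, nothing restated: `fromBlocks_mem_endAlgRat_prod_iff`
(seat p05's `ComplexTorusEndomorphismAlgebraProduct`), generation 7's `cyclicIdempotent` / `isIdempotentElem_cyclicIdempotent` /
`subRank_idemSubspace_eq_trace_rat` / `subRank_cyclicIdempotent_eq_totient_mul`, generation 9's `eigenvalueOrders` /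
`mem_eigenvalueOrders`, generation 27's `squarefree_charpoly_coe_iff_forall_cyclicMultiplicity_le_one` /
`cyclicMultiplicity_ne_zero_iff_mem_eigenvalueOrders` / `eigenvalueOrders_eq_singleton_of_charpoly_eq_cyclotomic` /
`eigenvalueOrders_gaussEnd` / `eigenvalueOrders_rotOmegaEnd`, FILE 3's `cyclicMultiplicity_eq_zero_iff_not_mem`,
FILE 5's `eigenvalueOrders_mul_eq`, Mathlib's `Matrix.fromBlocks_diagonal_pow` / `Matrix.charpoly_fromBlocks_zero₁₂` /
`Polynomial.aeval_subalgebra_coe`.  Theorems only; NO definition, NO named fact (D-0026, net debt 0); the diagonal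
endomorphism is carried as a hypothesis `hw : ρ_r(w) = ρ_r(u₁) ⊕ ρ_r(u₂)` (`fromBlocks_coe_mem_endAlgRat_prod` builds it).

## The print

* H. Lange, R. E. Rodríguez, *Decomposition of Jacobians by Prym Varieties*, LNM 2310 (2022), §2.9 Prop. 2.9.3 (i)
  (p0046: «`ρ_r = Σ_j h_j W_j`», `2 dim A_{W_j} = h_j [K_j : ℚ] dim V_j` — additive in direct sums of
  `G`-abelian varieties), §6.1.1 Prop. 6.1.2 (p0153).
* H. Lange, *Abelian Varieties over the Complex Numbers* (2023), §2.4.4 Cor. 2.4.26 (proof, p. 124: `End_ℚ` of a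
  product in block form), Cor. 2.4.28 («`dim X^ε = Tr_a(ε)`»), §2.4.5 Exercise (10) (p0126).
* A. Carocca, H. Lange, R. E. Rodríguez, Arch. Math. 112 (2019), §2.2 (p0004: the orders of the eigenvalues).
* I. Dolgachev, Yu. G. Zarhin (2024), §2.2 Thm. 2.18 (p0036) (the multiplicity-one / squarefree alternative).

## What is proved (`u_j ∈ End_ℚ(X_j)`, `w ∈ End_ℚ(X₁ × X₂)` with `ρ_r(w) = ρ_r(u₁) ⊕ ρ_r(u₂)`, `u_jⁿ = 1`, `n > 0`)

* §1 (matrices / any torus): `cyclicIdempotent_fromBlocks` (`E_{n,d}(A ⊕ B) = E_{n,d}(A) ⊕ E_{n,d}(B)`),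
  `coe_cyclicIdempotent` (`ρ_r(e_d(u)) = E_{n,d}(ρ_r(u))`).
* §2 PRODUCTS: `fromBlocks_coe_mem_endAlgRat_prod` (`ρ_r(u₁) ⊕ ρ_r(u₂) ∈ End_ℚ(X₁ × X₂)`),
  `pow_eq_one_of_coe_eq_fromBlocks` (`wⁿ = 1`), `charpoly_coe_eq_mul_of_coe_eq_fromBlocks` (`P^r_w = P^r_{u₁} P^r_{u₂}`),
  **`coe_cyclicIdempotent_eq_fromBlocks`** (`e_d(w) = (e_d(u₁), e_d(u₂))`), **`eigenvalueOrders_eq_union`**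
  (`D(w) = D(u₁) ∪ D(u₂)`), **`cyclicMultiplicity_eq_add`** (`h_d(w) = h_d(u₁) + h_d(u₂)`),
  **`squarefree_charpoly_coe_iff_of_coe_eq_fromBlocks`** / `squarefree_charpoly_fromBlocks_coe_iff`
  (`P^r_w` squarefree iff `P^r_{u₁}`, `P^r_{u₂}` squarefree ∧ `Disjoint D(u₁) D(u₂)`).
* §3 INSTANCES: `rotOmegaEnd_pow_six`, `charpoly_neg_rotOmegaEnd` (`P^r_{−ω} = Φ_6`), `eigenvalueOrders_rotOmegaEnd_six`
  (`D(ω) = {3}` with the exponent `6`), `eigenvalueOrders_neg_rotOmegaEnd` (`D(−ω) = {6}`),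
  **`squarefree_charpoly_fromBlocks_rotOmega_neg`** (`(ω, −ω)` is a certificate of `E_ω × E_ω`),
  `negGaussEnd_pow_four`, `charpoly_neg_gaussJ` (`P^r_{−i} = Φ_4`), `eigenvalueOrders_negGaussEnd` (`D(−i) = {4}`),
  **`not_squarefree_charpoly_fromBlocks_gaussJ_neg`** (`(i, −i)` is not).

## References

* [LangeRodriguez2022] H. Lange, R. E. Rodríguez, *Decomposition of Jacobians by Prym Varieties*, LNM 2310 (2022),
  §2.9 Prop. 2.9.3, §6.1.1 Prop. 6.1.2.
* [Lange2023AbelianVarietiesComplex] H. Lange, *Abelian Varieties over the Complex Numbers* (2023), §2.4.4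
  Cor. 2.4.26, Cor. 2.4.28, §2.4.5 Exercise (10).
* [CaroccaLangeRodriguez2019] A. Carocca, H. Lange, R. E. Rodríguez, Arch. Math. 112 (2019), §2.2.
* [DolgachevZarhin2024] I. Dolgachev, Yu. G. Zarhin, *Endomorphisms of Complex Abelian Varieties* (2024), §2.2 Thm. 2.18.
-/

noncomputable section

open Module Function Polynomial Finset
open scoped Matrix

namespace Literature.Geometry.Kaehler

/-! ### §1 The Chinese-remainder idempotents of a block-diagonal matrix -/

namespace CyclotomicIdempotents

section Blocks

variable {l m : Type*} [Fintype l] [Fintype m] [DecidableEq l] [DecidableEq m]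

/-- Polynomials of a block-diagonal matrix. [folklore] -/
private theorem aeval_fromBlocks_diag (A : Matrix l l ℚ) (D : Matrix m m ℚ) (s : ℚ[X]) :
    aeval (Matrix.fromBlocks A 0 0 D) s = Matrix.fromBlocks (aeval A s) 0 0 (aeval D s) := by
  rw [aeval_eq_sum_range (Matrix.fromBlocks A 0 0 D), aeval_eq_sum_range A, aeval_eq_sum_range D]
  induction (Finset.range (s.natDegree + 1)) using Finset.induction_on with
  | empty => simp [Matrix.fromBlocks_zero]
  | insert i S hi ih =>
    rw [Finset.sum_insert hi, Finset.sum_insert hi, Finset.sum_insert hi, ih, Matrix.fromBlocks_diagonal_pow,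
      Matrix.fromBlocks_smul, Matrix.fromBlocks_add]
    simp only [smul_zero, add_zero]

/-- **`E_{n,d}(A ⊕ B) = E_{n,d}(A) ⊕ E_{n,d}(B)`** — the isotypic idempotents of a block-diagonal matrix are
block-diagonal. [cite: LangeRodriguez2022, §2.9 (2.26) and Prop. 2.9.3, p0042, p0046] -/
theorem cyclicIdempotent_fromBlocks (A : Matrix l l ℚ) (D : Matrix m m ℚ) (n d : ℕ) :
    cyclicIdempotent n (Matrix.fromBlocks A 0 0 D) d =
      Matrix.fromBlocks (cyclicIdempotent n A d) 0 0 (cyclicIdempotent n D d) := by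
  rw [cyclicIdempotent, cyclicIdempotent, cyclicIdempotent, aeval_fromBlocks_diag]

end Blocks

end CyclotomicIdempotents

namespace ComplexTorus

open CyclotomicIdempotents

section OneTorus

variable {ι : Type*} [Fintype ι] [DecidableEq ι] {E : Type*} [NormedAddCommGroup E] [NormedSpace ℂ E]
  {Φ : (ι → ℝ) ≃L[ℝ] E} {n : ℕ} {u : endAlgRat Φ}

/-- `ρ_r(e_d(u)) = E_{n,d}(ρ_r(u))` — the matrix of the isotypic idempotent is the idempotent of the matrix.
[cite: LangeRodriguez2022, §2.9 (2.26), p0042] -/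
theorem coe_cyclicIdempotent (d : ℕ) :
    ((cyclicIdempotent n u d : endAlgRat Φ) : Matrix ι ι ℚ) = cyclicIdempotent n (u : Matrix ι ι ℚ) d := by
  rw [cyclicIdempotent, aeval_subalgebra_coe, cyclicIdempotent]

end OneTorus

/-! ### §2 Diagonal endomorphisms of `X₁ × X₂` -/

section Product

variable {ι₁ ι₂ : Type*} [Fintype ι₁] [Fintype ι₂] [DecidableEq ι₁] [DecidableEq ι₂]
  {E₁ E₂ : Type*} [NormedAddCommGroup E₁] [NormedSpace ℂ E₁] [NormedAddCommGroup E₂] [NormedSpace ℂ E₂]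
  {Φ₁ : (ι₁ → ℝ) ≃L[ℝ] E₁} {Φ₂ : (ι₂ → ℝ) ≃L[ℝ] E₂} {n : ℕ} {u₁ : endAlgRat Φ₁} {u₂ : endAlgRat Φ₂}
  {w : endAlgRat (prodPeriod Φ₁ Φ₂)}

omit [DecidableEq ι₁] [DecidableEq ι₂] in
/-- Trace of a block matrix. [folklore] -/
private theorem trace_fromBlocks'' (A : Matrix ι₁ ι₁ ℚ) (B : Matrix ι₁ ι₂ ℚ) (C : Matrix ι₂ ι₁ ℚ)
    (D : Matrix ι₂ ι₂ ℚ) : (Matrix.fromBlocks A B C D).trace = A.trace + D.trace := by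
  simp [Matrix.trace, Fintype.sum_sum_type]

/-- **`ρ_r(u₁) ⊕ ρ_r(u₂) ∈ End_ℚ(X₁ × X₂)`** — the diagonal endomorphism `(u₁, u₂)`.
[cite: Lange2023AbelianVarietiesComplex, §2.4.4 Cor. 2.4.26 (proof: block form), p. 124] -/
theorem fromBlocks_coe_mem_endAlgRat_prod (u₁ : endAlgRat Φ₁) (u₂ : endAlgRat Φ₂) :
    Matrix.fromBlocks (u₁ : Matrix ι₁ ι₁ ℚ) 0 0 (u₂ : Matrix ι₂ ι₂ ℚ) ∈ endAlgRat (prodPeriod Φ₁ Φ₂) :=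
  (fromBlocks_mem_endAlgRat_prod_iff _ _).2 ⟨u₁.2, Submodule.zero_mem _, Submodule.zero_mem _, u₂.2⟩

/-- `(u₁, u₂)ⁿ = 1` when `u₁ⁿ = u₂ⁿ = 1`. [cite: Lange2023AbelianVarietiesComplex, §2.4.4 Cor. 2.4.26 (proof), p. 124] -/
theorem pow_eq_one_of_coe_eq_fromBlocks
    (hw : (w : Matrix (ι₁ ⊕ ι₂) (ι₁ ⊕ ι₂) ℚ) = Matrix.fromBlocks (u₁ : Matrix ι₁ ι₁ ℚ) 0 0 (u₂ : Matrix ι₂ ι₂ ℚ))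
    (hu₁ : u₁ ^ n = 1) (hu₂ : u₂ ^ n = 1) : w ^ n = 1 := by
  apply Subtype.ext
  rw [SubmonoidClass.coe_pow, hw, Matrix.fromBlocks_diagonal_pow, ← SubmonoidClass.coe_pow u₁,
    ← SubmonoidClass.coe_pow u₂, hu₁, hu₂]
  simp only [OneMemClass.coe_one, Matrix.fromBlocks_one]

/-- **`P^r_{(u₁, u₂)} = P^r_{u₁} · P^r_{u₂}`.** [cite: Lange2023AbelianVarietiesComplex, §2.4.4 Cor. 2.4.26 (proof), p. 124] -/
theorem charpoly_coe_eq_mul_of_coe_eq_fromBlocks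
    (hw : (w : Matrix (ι₁ ⊕ ι₂) (ι₁ ⊕ ι₂) ℚ) = Matrix.fromBlocks (u₁ : Matrix ι₁ ι₁ ℚ) 0 0 (u₂ : Matrix ι₂ ι₂ ℚ)) :
    (w : Matrix (ι₁ ⊕ ι₂) (ι₁ ⊕ ι₂) ℚ).charpoly = (u₁ : Matrix ι₁ ι₁ ℚ).charpoly * (u₂ : Matrix ι₂ ι₂ ℚ).charpoly := by
  rw [hw, Matrix.charpoly_fromBlocks_zero₁₂]

/-- **`e_d(u₁, u₂) = (e_d(u₁), e_d(u₂))`** — the isotypic idempotents of a diagonal endomorphism are diagonal.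
[cite: LangeRodriguez2022, §2.9 (2.26), p0042; Prop. 2.9.3, p0046] -/
theorem coe_cyclicIdempotent_eq_fromBlocks
    (hw : (w : Matrix (ι₁ ⊕ ι₂) (ι₁ ⊕ ι₂) ℚ) = Matrix.fromBlocks (u₁ : Matrix ι₁ ι₁ ℚ) 0 0 (u₂ : Matrix ι₂ ι₂ ℚ))
    (d : ℕ) :
    ((cyclicIdempotent n w d : endAlgRat (prodPeriod Φ₁ Φ₂)) : Matrix (ι₁ ⊕ ι₂) (ι₁ ⊕ ι₂) ℚ) =
      Matrix.fromBlocks ((cyclicIdempotent n u₁ d : endAlgRat Φ₁) : Matrix ι₁ ι₁ ℚ) 0 0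
        ((cyclicIdempotent n u₂ d : endAlgRat Φ₂) : Matrix ι₂ ι₂ ℚ) := by
  rw [coe_cyclicIdempotent, coe_cyclicIdempotent, coe_cyclicIdempotent, hw, cyclicIdempotent_fromBlocks]

/-- **`D(u₁, u₂) = D(u₁) ∪ D(u₂)`** — the eigenvalue orders of a diagonal endomorphism.
[cite: CaroccaLangeRodriguez2019, §2.2 («the orders of the eigenvalues of `α`»), p0004] -/
theorem eigenvalueOrders_eq_union
    (hw : (w : Matrix (ι₁ ⊕ ι₂) (ι₁ ⊕ ι₂) ℚ) = Matrix.fromBlocks (u₁ : Matrix ι₁ ι₁ ℚ) 0 0 (u₂ : Matrix ι₂ ι₂ ℚ)) :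
    eigenvalueOrders n w = eigenvalueOrders n u₁ ∪ eigenvalueOrders n u₂ := by
  ext d
  have key : cyclicIdempotent n w d = 0 ↔ cyclicIdempotent n u₁ d = 0 ∧ cyclicIdempotent n u₂ d = 0 := by
    rw [← ZeroMemClass.coe_eq_zero (x := cyclicIdempotent n w d), coe_cyclicIdempotent_eq_fromBlocks hw,
      ← Matrix.fromBlocks_zero, Matrix.fromBlocks_inj, ZeroMemClass.coe_eq_zero, ZeroMemClass.coe_eq_zero]
    simp only [true_and]
  rw [Finset.mem_union, mem_eigenvalueOrders, mem_eigenvalueOrders, mem_eigenvalueOrders, Ne, key]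
  tauto

/-- **`h_d(u₁, u₂) = h_d(u₁) + h_d(u₂)`** (`d ∣ n`): `rk Λ(X^{e_d(w)}) = Tr e_d(w) = Tr e_d(u₁) + Tr e_d(u₂)`.
[cite: LangeRodriguez2022, §2.9 Prop. 2.9.3 (i), p0046] [cite: Lange2023AbelianVarietiesComplex, §2.4.4 Cor. 2.4.28 («`dim X^ε = Tr(ε)`»)] -/
theorem cyclicMultiplicity_eq_add
    (hw : (w : Matrix (ι₁ ⊕ ι₂) (ι₁ ⊕ ι₂) ℚ) = Matrix.fromBlocks (u₁ : Matrix ι₁ ι₁ ℚ) 0 0 (u₂ : Matrix ι₂ ι₂ ℚ))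
    (hn : 0 < n) (hu₁ : u₁ ^ n = 1) (hu₂ : u₂ ^ n = 1) {d : ℕ} (hd : d ∈ n.divisors) :
    cyclicMultiplicity (prodPeriod Φ₁ Φ₂) n w d = cyclicMultiplicity Φ₁ n u₁ d + cyclicMultiplicity Φ₂ n u₂ d := by
  have hw' := pow_eq_one_of_coe_eq_fromBlocks hw hu₁ hu₂
  have hφ : 0 < Nat.totient d := Nat.totient_pos.2 (Nat.pos_of_mem_divisors hd)
  apply Nat.eq_of_mul_eq_mul_left hφ
  rw [mul_add, ← subRank_cyclicIdempotent_eq_totient_mul _ hn hw' hd,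
    ← subRank_cyclicIdempotent_eq_totient_mul _ hn hu₁ hd, ← subRank_cyclicIdempotent_eq_totient_mul _ hn hu₂ hd]
  have h := subRank_idemSubspace_eq_trace_rat (prodPeriod Φ₁ Φ₂) (isIdempotentElem_cyclicIdempotent hn hw' d)
  have h1 := subRank_idemSubspace_eq_trace_rat Φ₁ (isIdempotentElem_cyclicIdempotent hn hu₁ d)
  have h2 := subRank_idemSubspace_eq_trace_rat Φ₂ (isIdempotentElem_cyclicIdempotent hn hu₂ d)
  have htr : ((cyclicIdempotent n w d : endAlgRat (prodPeriod Φ₁ Φ₂)) : Matrix (ι₁ ⊕ ι₂) (ι₁ ⊕ ι₂) ℚ).trace =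
      ((cyclicIdempotent n u₁ d : endAlgRat Φ₁) : Matrix ι₁ ι₁ ℚ).trace +
        ((cyclicIdempotent n u₂ d : endAlgRat Φ₂) : Matrix ι₂ ι₂ ℚ).trace := by
    rw [coe_cyclicIdempotent_eq_fromBlocks hw, trace_fromBlocks'']
  rw [htr, ← h1, ← h2] at h
  exact_mod_cast h

/-- **THE CERTIFICATE ON A PRODUCT: `P^r_{(u₁, u₂)}` is squarefree iff `P^r_{u₁}` and `P^r_{u₂}` are squarefree and
`D(u₁) ∩ D(u₂) = ∅`** (`h_d(u₁) + h_d(u₂) ≤ 1` for all `d ∣ n`). [cite: LangeRodriguez2022, §2.9 Prop. 2.9.3 («`ρ_r = Σ_j h_j W_j`») and §6.1.1 Prop. 6.1.2, p0046, p0153]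
[cite: DolgachevZarhin2024, §2.2 Thm. 2.18, p0036] -/
theorem squarefree_charpoly_coe_iff_of_coe_eq_fromBlocks
    (hw : (w : Matrix (ι₁ ⊕ ι₂) (ι₁ ⊕ ι₂) ℚ) = Matrix.fromBlocks (u₁ : Matrix ι₁ ι₁ ℚ) 0 0 (u₂ : Matrix ι₂ ι₂ ℚ))
    (hn : 0 < n) (hu₁ : u₁ ^ n = 1) (hu₂ : u₂ ^ n = 1) :
    Squarefree (w : Matrix (ι₁ ⊕ ι₂) (ι₁ ⊕ ι₂) ℚ).charpoly ↔
      Squarefree (u₁ : Matrix ι₁ ι₁ ℚ).charpoly ∧ Squarefree (u₂ : Matrix ι₂ ι₂ ℚ).charpoly ∧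
        Disjoint (eigenvalueOrders n u₁) (eigenvalueOrders n u₂) := by
  have hw' := pow_eq_one_of_coe_eq_fromBlocks hw hu₁ hu₂
  rw [squarefree_charpoly_coe_iff_forall_cyclicMultiplicity_le_one _ hn hw',
    squarefree_charpoly_coe_iff_forall_cyclicMultiplicity_le_one _ hn hu₁,
    squarefree_charpoly_coe_iff_forall_cyclicMultiplicity_le_one _ hn hu₂, Finset.disjoint_left]
  constructor
  · intro h
    refine ⟨fun d hd ↦ ?_, fun d hd ↦ ?_, fun d hd₁ hd₂ ↦ ?_⟩
    · have h' := h d hd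
      rw [cyclicMultiplicity_eq_add hw hn hu₁ hu₂ hd] at h'
      omega
    · have h' := h d hd
      rw [cyclicMultiplicity_eq_add hw hn hu₁ hu₂ hd] at h'
      omega
    · have hdn := (mem_eigenvalueOrders.1 hd₁).1
      have h1 := (cyclicMultiplicity_ne_zero_iff_mem_eigenvalueOrders Φ₁ hn hu₁ hdn).2 hd₁
      have h2 := (cyclicMultiplicity_ne_zero_iff_mem_eigenvalueOrders Φ₂ hn hu₂ hdn).2 hd₂
      have h' := h d hdn
      rw [cyclicMultiplicity_eq_add hw hn hu₁ hu₂ hdn] at h'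
      omega
  · rintro ⟨h1, h2, h3⟩ d hd
    rw [cyclicMultiplicity_eq_add hw hn hu₁ hu₂ hd]
    by_cases hd₁ : d ∈ eigenvalueOrders n u₁
    · rw [(cyclicMultiplicity_eq_zero_iff_not_mem hn hu₂ hd).2 (h3 hd₁), add_zero]
      exact h1 d hd
    · rw [(cyclicMultiplicity_eq_zero_iff_not_mem hn hu₁ hd).2 hd₁, zero_add]
      exact h2 d hd

/-- Matrix form of the certificate on a product: **`P^r_{ρ_r(u₁) ⊕ ρ_r(u₂)}` is squarefree iff `P^r_{u₁}`, `P^r_{u₂}`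
are squarefree and `D(u₁) ∩ D(u₂) = ∅`.** [cite: LangeRodriguez2022, §2.9 Prop. 2.9.3 and §6.1.1 Prop. 6.1.2, p0046, p0153]
[cite: DolgachevZarhin2024, §2.2 Thm. 2.18, p0036] -/
theorem squarefree_charpoly_fromBlocks_coe_iff (hn : 0 < n) (hu₁ : u₁ ^ n = 1) (hu₂ : u₂ ^ n = 1) :
    Squarefree (Matrix.fromBlocks (u₁ : Matrix ι₁ ι₁ ℚ) 0 0 (u₂ : Matrix ι₂ ι₂ ℚ)).charpoly ↔
      Squarefree (u₁ : Matrix ι₁ ι₁ ℚ).charpoly ∧ Squarefree (u₂ : Matrix ι₂ ι₂ ℚ).charpoly ∧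
        Disjoint (eigenvalueOrders n u₁) (eigenvalueOrders n u₂) :=
  squarefree_charpoly_coe_iff_of_coe_eq_fromBlocks
    (w := ⟨Matrix.fromBlocks (u₁ : Matrix ι₁ ι₁ ℚ) 0 0 (u₂ : Matrix ι₂ ι₂ ℚ), fromBlocks_coe_mem_endAlgRat_prod u₁ u₂⟩)
    rfl hn hu₁ hu₂

end Product

/-! ### §3 Instances: `(ω, −ω)` on `E_ω × E_ω` is a certificate, `(i, −i)` on `E_i × E_i` is not -/

section Instances

/-- `ω⁶ = 1` on `E_ω`. [cite: Lange2023AbelianVarietiesComplex, §2.4.5 Exercise (10), p0126] -/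
theorem rotOmegaEnd_pow_six : (rotOmegaEnd : endAlgRat (ellipticPeriod omega_im_ne_zero)) ^ 6 = 1 := by
  rw [show (6 : ℕ) = 3 * 2 from rfl, pow_mul, rotOmegaEnd_pow_three, one_pow]

/-- `(−ω)⁶ = 1` on `E_ω`. [cite: Lange2023AbelianVarietiesComplex, §2.4.5 Exercise (10), p0126] -/
theorem neg_rotOmegaEnd_pow_six : (-rotOmegaEnd : endAlgRat (ellipticPeriod omega_im_ne_zero)) ^ 6 = 1 := by
  rw [Even.neg_pow (by decide : Even 6) rotOmegaEnd, rotOmegaEnd_pow_six]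

/-- **`P^r_{−ω} = x² − x + 1 = Φ_6`** on `E_ω` (`−ω = e^{2πi/6}`... the primitive sixth root `−ω = ω̄ + 1`).
[cite: LangeRodriguez2022, §6.1.1 («`K_d = ℚ(ξ_d)`», `d = 6`), p0152] -/
theorem charpoly_neg_rotOmegaEnd :
    ((-rotOmegaEnd : endAlgRat (ellipticPeriod omega_im_ne_zero)) : Matrix (Fin 2) (Fin 2) ℚ).charpoly =
      cyclotomic 6 ℚ := by
  rw [NegMemClass.coe_neg, show ((rotOmegaEnd : endAlgRat (ellipticPeriod omega_im_ne_zero)) :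
      Matrix (Fin 2) (Fin 2) ℚ) = rotOmega.map (Int.cast : ℤ → ℚ) from rfl, Matrix.charpoly_fin_two, cyclotomic_six]
  simp [rotOmega, Matrix.trace_fin_two, Matrix.det_fin_two]

/-- `D(ω) = {3}` computed with the exponent `6` (FILE 5: the orders do not depend on the exponent).
[cite: CaroccaLangeRodriguez2019, §2.2, p0004] -/
theorem eigenvalueOrders_rotOmegaEnd_six : eigenvalueOrders 6 (rotOmegaEnd : endAlgRat (ellipticPeriod omega_im_ne_zero)) = {3} := by
  rw [show (6 : ℕ) = 3 * 2 from rfl, eigenvalueOrders_mul_eq (by norm_num) rotOmegaEnd_pow_three two_pos,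
    eigenvalueOrders_rotOmegaEnd]

/-- **`D(−ω) = {6}`** on `E_ω`. [cite: CaroccaLangeRodriguez2019, §2.2, p0004] -/
theorem eigenvalueOrders_neg_rotOmegaEnd :
    eigenvalueOrders 6 (-rotOmegaEnd : endAlgRat (ellipticPeriod omega_im_ne_zero)) = {6} :=
  eigenvalueOrders_eq_singleton_of_charpoly_eq_cyclotomic (by norm_num) neg_rotOmegaEnd_pow_six (dvd_refl 6)
    charpoly_neg_rotOmegaEnd

/-- **`E_ω × E_ω`: the DIAGONAL automorphism `(ω, −ω)` of order `6` is a CM certificate** — `P^r = Φ_3 Φ_6 = x⁴ + x² + 1`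
is squarefree since `D(ω) = {3}` and `D(−ω) = {6}` are disjoint (contrast: on `E_i × E_i` the diagonal `(i, ±i)` fail
and only the non-diagonal `swapI` of FILE 1 passes). [cite: LangeRodriguez2022, §6.1.1 Prop. 6.1.2, p0153]
[cite: Lange2023AbelianVarietiesComplex, §2.4.5 Exercise (10), p0126] -/
theorem squarefree_charpoly_fromBlocks_rotOmega_neg :
    Squarefree (Matrix.fromBlocks (rotOmega.map (Int.cast : ℤ → ℚ)) 0 0 (-(rotOmega.map (Int.cast : ℤ → ℚ)))).charpoly := by
  have key := squarefree_charpoly_fromBlocks_coe_iff (n := 6)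
    (u₁ := (rotOmegaEnd : endAlgRat (ellipticPeriod omega_im_ne_zero)))
    (u₂ := (-rotOmegaEnd : endAlgRat (ellipticPeriod omega_im_ne_zero))) (by norm_num) rotOmegaEnd_pow_six
    neg_rotOmegaEnd_pow_six
  rw [eigenvalueOrders_rotOmegaEnd_six, eigenvalueOrders_neg_rotOmegaEnd] at key
  have h := key.2 ⟨squarefree_charpoly_rotOmegaEnd,
    by rw [charpoly_neg_rotOmegaEnd]; exact (cyclotomic.irreducible_rat (by norm_num)).squarefree, by decide⟩
  rw [NegMemClass.coe_neg] at h
  exact h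

variable (hI : Complex.I.im ≠ 0)

/-- `(−i)⁴ = 1` on `E_i` (`−i = ρ_r(z ↦ −iz) ∈ End_ℚ(E_i)`). [cite: Lange2023AbelianVarietiesComplex, §2.4.5 Exercise (10), p0126] -/
theorem negGaussEnd_pow_four :
    (⟨-gaussJ, neg_mem (gaussJ_mem_endAlgRat hI)⟩ : endAlgRat (ellipticPeriod hI)) ^ 4 = 1 := by
  apply Subtype.ext
  rw [SubmonoidClass.coe_pow, OneMemClass.coe_one]
  change (-gaussJ) ^ 4 = 1
  rw [Even.neg_pow (by decide : Even 4) gaussJ, gaussJ_pow_four]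

/-- **`P^r_{−i} = Φ_4`** on `E_i` (the same as `P^r_i`). [cite: LangeRodriguez2022, §6.1.1 («`K_d = ℚ(ξ_d)`», `d = 4`), p0152] -/
theorem charpoly_neg_gaussJ : (-gaussJ).charpoly = cyclotomic 4 ℚ := by
  rw [← charpoly_gaussJ, charpoly_gaussJ_eq_X_sq_add_one, Matrix.charpoly_fin_two]
  simp [gaussJ, Matrix.trace_fin_two, Matrix.det_fin_two]

/-- **`D(−i) = {4} = D(i)`** on `E_i`. [cite: CaroccaLangeRodriguez2019, §2.2, p0004] -/
theorem eigenvalueOrders_negGaussEnd :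
    eigenvalueOrders 4 (⟨-gaussJ, neg_mem (gaussJ_mem_endAlgRat hI)⟩ : endAlgRat (ellipticPeriod hI)) = {4} :=
  eigenvalueOrders_eq_singleton_of_charpoly_eq_cyclotomic (by norm_num) (negGaussEnd_pow_four hI) (dvd_refl 4)
    charpoly_neg_gaussJ

/-- **`E_i × E_i`: the diagonal automorphism `(i, −i)` is NOT a certificate** (`D(i) = D(−i) = {4}` collide:
`P^r = Φ_4²`), like `(i, i)` (generation 27). [cite: LangeRodriguez2022, §6.1.1 Prop. 6.1.2, p0153] [cite: DolgachevZarhin2024, §2.2 Thm. 2.18 (second alternative), p0036] -/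
theorem not_squarefree_charpoly_fromBlocks_gaussJ_neg :
    ¬ Squarefree (Matrix.fromBlocks gaussJ 0 0 (-gaussJ)).charpoly := by
  have key := squarefree_charpoly_fromBlocks_coe_iff (n := 4)
    (u₁ := (⟨gaussJ, gaussJ_mem_endAlgRat I_im_ne_zero⟩ : endAlgRat (ellipticPeriod I_im_ne_zero)))
    (u₂ := (⟨-gaussJ, neg_mem (gaussJ_mem_endAlgRat I_im_ne_zero)⟩ : endAlgRat (ellipticPeriod I_im_ne_zero)))
    (by norm_num) (gaussEnd_pow_four I_im_ne_zero) (negGaussEnd_pow_four I_im_ne_zero)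
  rw [eigenvalueOrders_gaussEnd, eigenvalueOrders_negGaussEnd] at key
  intro h
  exact absurd (key.1 h).2.2 (by decide)

end Instances

end ComplexTorus

end Literature.Geometry.Kaehler
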